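import Summits.CriticalPhenomena.PercolationContinuityZ3.Theorems.Transplant.SkelDropAssembly
import HarnessLib

/-!
# L7.0″ — RE-CENTRING a planar skeleton at the root (`φ ↦ φ − φ t`): `PlanarSkeleton.shift`, `PlanarSkeletonConc.shift`, invariance of
# types / cylinders / cylinder subcriticality, and the "WLOG `φ t = 0`" reductions of the node of record and of the generic (D) assembly top

builds on p205010 (kernel theorem, internal audit signed; external expert review pending) — nothing in this file uses p205010.
Status sentence (coordinator 2026-08-20T04:30Z): "θ(p_c) = 0 on ℤ^d, all d ≥ 2 — kernel-verified (Lean 4/Mathlib, standard axioms); internal adversarial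
audit SIGNED 2026-08-20 04:29Z; external expert review pending."
Lane `prim-bschramm-*`, seat `prim-bschramm-stmt` (gen 7); helper file (`--supports stmt-CriticalPhenomena-4575`).
WHY: the node `SamePDropOfSkeletonConcLt` quantifies over every base vertex `t ∈ Φ.types` of an arbitrary `PlanarSkeletonConc Φ`, while the
generic cell geometry of record (p2-g3's `SkelCellsConcG`, L3.1: regions = vertex spans of windows over p3's planar cells `C.Q x`, centred at
`cen x = 20 r x`) is typed under the normalisation `Φ.φ w₀ = 0`.  Subtracting the constant `φ t` from `φ` changes none of the skeleton
axioms (`lip`, `frame`, `point`, `step` are translation-covariant; `types`, the cylinders `cyl t ℓ = {w : φ w − φ t ∈ Λ_ℓ}`, hence (κ) and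
`CylSubcritical`, are literally unchanged), so the closure re-centres once, here, and every later generic file may assume `Φ.φ t = 0`.

* `PlanarSkeleton.shift Φ c` (`φ ↦ φ − c`), `shift_φ`, `shift_types`, `shift_cyl`, `shift_prism`, **`shift_cylSubcritical_iff`**;
* `PlanarSkeletonConc.shift Φ c` (same `Δ`/`degree_le`; `step`, `cyl_connected` transported), `shift_toPlanarSkeleton`, `shift_types`, `shift_Δ`,
  **`shift_φ_self : (Φ.shift (Φ.φ t)).φ t = 0`**;
* **`SkelConc.samePDropOfSkeletonConcLt_of_centred`** — it suffices to prove the node for skeletons with `Φ.φ t = 0` at the base vertex in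
  question; **`SkelConc.samePDropOfSkeletonConcLt_of_inputs_run_centred`** — the generic (D) assembly top (`SkelDropAssembly`, p230703) with the
  extra hypothesis `Φ.φ t = 0` handed to the instance.
[cite: KozmaNitzan2024, §4 p. 15 (the role of the symmetries of ℤ^d), §1 p. 2 (approach 1)]
-/

noncomputable section

open MeasureTheory ProbabilityTheory
open scoped ENNReal Classical

namespace Summit.CriticalPhenomena.PercolationContinuityZ3.Theorems

namespace Transplant

open Literature.Probability.Percolation Literature.Probability.LatticeModels SimpleGraph KNCells
open Literature.Probability.Percolation.GM
open Literature.Barriers.CriticalPhenomena (graphBall)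

/-! ## §1 Shifting a planar skeleton by a constant -/

namespace PlanarSkeleton

variable {V : Type} {G : SimpleGraph V} (Φ : PlanarSkeleton G) (c : Site 2)

/-- **The shifted skeleton `φ − c`**: same base vertices, frames and point group. [this work] -/
def shift : PlanarSkeleton G where
  φ := fun v => Φ.φ v - c
  lip := by
    intro u v h i
    have h' := Φ.lip h i
    simp only [Pi.sub_apply] at h' ⊢
    rwa [sub_sub_sub_cancel_right]
  types := Φ.types
  frame := fun v => by
    obtain ⟨t, ht, α, hαt, hα⟩ := Φ.frame v
    refine ⟨t, ht, α, hαt, fun w => ?_⟩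
    rw [hα w, sub_sub_sub_cancel_right]
    abel
  point := fun t ht g => by
    obtain ⟨α, hαt, hα⟩ := Φ.point t ht g
    refine ⟨α, hαt, fun w => ?_⟩
    rw [sub_sub_sub_cancel_right, sub_sub_sub_cancel_right]
    exact hα w

/-- The shifted skeleton map. [folklore] -/
@[simp] theorem shift_φ (v : V) : (Φ.shift c).φ v = Φ.φ v - c := rfl

/-- The base vertices are unchanged. [folklore] -/
@[simp] theorem shift_types : (Φ.shift c).types = Φ.types := rfl

/-- **Cylinders are unchanged** (`(φ w − c) − (φ t − c) = φ w − φ t`). [folklore] -/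
@[simp] theorem shift_cyl (t : V) (ℓ : ℕ) : (Φ.shift c).cyl t ℓ = Φ.cyl t ℓ := by
  ext w
  simp only [mem_cyl, shift_φ, sub_sub_sub_cancel_right]

/-- Prisms are unchanged. [folklore] -/
@[simp] theorem shift_prism (t : V) (R ℓ : ℕ) : (Φ.shift c).prism t R ℓ = Φ.prism t R ℓ := by
  ext w
  simp only [mem_prism, shift_φ, sub_sub_sub_cancel_right]

omit Φ c in
/-- `θ` on an induced subgraph depends only on the inducing SET (transport along a set equality). [folklore] -/
theorem theta_induce_congr [Countable V] {S T : Set V} (h : S = T) {t : V} (hS : t ∈ S) (p : unitInterval) :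
    theta (G.induce S) ⟨t, hS⟩ p = theta (G.induce T) ⟨t, h ▸ hS⟩ p := by
  subst h; rfl

/-- **Cylinder subcriticality is unchanged by a shift.** [folklore] -/
theorem shift_cylSubcritical_iff [Countable V] (p : unitInterval) : (Φ.shift c).CylSubcritical p ↔ Φ.CylSubcritical p := by
  unfold CylSubcritical
  refine forall₂_congr fun t _ => forall_congr' fun ℓ => ?_
  rw [theta_induce_congr (Φ.shift_cyl c t ℓ) ((Φ.shift c).mem_cyl_self t ℓ) p]

end PlanarSkeleton

/-! ## §2 Shifting a `PlanarSkeletonConc` -/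

namespace PlanarSkeletonConc

variable {V : Type} {G : SimpleGraph V} [G.LocallyFinite] (Φ : PlanarSkeletonConc G) (c : Site 2)

/-- **The shifted `PlanarSkeletonConc`** (`φ ↦ φ − c`; `Δ`, `degree_le` unchanged; (ι) and (κ) transported). [this work] -/
def shift : PlanarSkeletonConc G where
  toPlanarSkeleton := Φ.toPlanarSkeleton.shift c
  Δ := Φ.Δ
  degree_le := Φ.degree_le
  step := fun v i σ => by
    obtain ⟨v', hadj, hφ⟩ := Φ.step v i σ
    refine ⟨v', hadj, ?_⟩
    show Φ.φ v' - c = Φ.φ v - c + Pi.single i (σ : ℤ)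
    rw [hφ]
    abel
  cyl_connected := fun t ht ℓ hℓ => by
    have hS : {w : V | (Φ.toPlanarSkeleton.shift c).φ w - (Φ.toPlanarSkeleton.shift c).φ t ∈ box 2 ℓ} =
        {w : V | Φ.φ w - Φ.φ t ∈ box 2 ℓ} := by
      ext w
      simp only [Set.mem_setOf_eq, PlanarSkeleton.shift_φ, sub_sub_sub_cancel_right]
    rw [hS]
    exact Φ.cyl_connected t ht ℓ hℓ

/-- The underlying shifted skeleton. [folklore] -/
@[simp] theorem shift_toPlanarSkeleton : (Φ.shift c).toPlanarSkeleton = Φ.toPlanarSkeleton.shift c := rfl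

/-- The shifted skeleton map. [folklore] -/
@[simp] theorem shift_φ (v : V) : (Φ.shift c).φ v = Φ.φ v - c := rfl

/-- The base vertices are unchanged. [folklore] -/
@[simp] theorem shift_types : (Φ.shift c).types = Φ.types := rfl

/-- The degree bound is unchanged. [folklore] -/
@[simp] theorem shift_Δ : (Φ.shift c).Δ = Φ.Δ := rfl

/-- **Re-centring at `t`: `(Φ.shift (φ t)).φ t = 0`.** [folklore] -/
@[simp] theorem shift_φ_self (t : V) : (Φ.shift (Φ.φ t)).φ t = 0 := sub_self _

/-- Cylinder subcriticality is unchanged by a shift (the `Conc` form). [folklore] -/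
theorem shift_cylSubcritical_iff [Countable V] (p : unitInterval) :
    (Φ.shift c).toPlanarSkeleton.CylSubcritical p ↔ Φ.toPlanarSkeleton.CylSubcritical p :=
  Φ.toPlanarSkeleton.shift_cylSubcritical_iff c p

end PlanarSkeletonConc

/-! ## §3 WLOG `φ t = 0` in the node of record and in the generic assembly top -/

namespace SkelConc

/-- **It suffices to prove the node of record for skeletons centred at the base vertex** (`Φ.φ t = 0`): re-centre by `Φ.shift (Φ.φ t)`.
[cite: KozmaNitzan2024, §4 p. 15 (the role of the symmetries of ℤ^d)] -/
theorem samePDropOfSkeletonConcLt_of_centred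
    (h : ∀ {V : Type} [DecidableEq V] [Countable V] (G : SimpleGraph V) [G.LocallyFinite] (Φ : PlanarSkeletonConc G),
      G.Connected → ∀ t ∈ Φ.types, Φ.φ t = 0 → ∀ p : unitInterval, (p : ℝ) < 1 →
        (∀ᵐ ω ∂bondPercolation G p, numInfiniteClusters ω ≤ 1) → Φ.toPlanarSkeleton.CylSubcritical p → 0 < theta G t p →
          ∃ q : unitInterval, (q : ℝ) < p ∧ 0 < theta G t q) :
    SamePDropOfSkeletonConcLt := by
  intro V _ _ G _ Φ hc t ht p hp1 hU hC hθ
  exact h G (Φ.shift (Φ.φ t)) hc t (by simpa using ht) (Φ.shift_φ_self t) p hp1 hU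
    ((Φ.shift_cylSubcritical_iff (Φ.φ t) p).2 hC) hθ

/-- **THE GENERIC (D) ASSEMBLY, run-restricted form, CENTRED**: `samePDropOfSkeletonConcLt_of_inputs_run'` (p230703) with the normalisation
`Φ.φ t = 0` available to the instance (A)/(B). [cite: KozmaNitzan2024, §1 p. 2 (approach 1), §4 Theorem 6 (pp. 25–31)] -/
theorem samePDropOfSkeletonConcLt_of_inputs_run_centred
    (h : ∀ {V : Type} [DecidableEq V] [Countable V] (G : SimpleGraph V) [G.LocallyFinite] (Φ : PlanarSkeletonConc G),
      G.Connected → ∀ t ∈ Φ.types, Φ.φ t = 0 → ∀ p : unitInterval, (p : ℝ) < 1 →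
        (∀ᵐ ω ∂bondPercolation G p, numInfiniteClusters ω ≤ 1) → Φ.toPlanarSkeleton.CylSubcritical p → 0 < theta G t p →
          ∃ (ι : Type) (s : Finset ι) (A : ι → Set (BondConfig V)) (F : ι → Finset (Sym2 V)) (c : ι → ℝ),
            (∀ i ∈ s, DeterminedBy (A i) (↑(F i) : Set (Sym2 V))) ∧
            (∀ i ∈ s, c i < (bondPercolation G p).real (A i)) ∧
            ∀ q : unitInterval, (p : ℝ) / 2 ≤ q → (q : ℝ) ≤ p →
              (∀ i ∈ s, c i < (bondPercolation G q).real (A i)) →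
              Φ.toPlanarSkeleton.CylSubcritical q →
                ∃ (A : Type) (S : KSchA V A) (FD : FaceData V A) (LD : LevelData V A) (ε' δ₂ : ℝ),
                  S.Γ.root = t ∧ S.p = q ∧
                  RunGeom G S.Γ ∧ AnchGeom S.Γ ∧ SepGeom₂ G S.Γ ∧ ExitGeom G S.Γ ∧ StepsGeom S.Γ FD ∧ LevelGeom G S.Γ FD LD ∧
                  S.δc ≤ 1 ∧ 0 ≤ ε' ∧ δ₂ ≤ 1 ∧ 4 * ((1 - δ₂) ^ S.Γ.K + ε') ≤ (1 / 2) ^ 32 ∧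
                  KSchA.KitAtRun G S FD δ₂ ε') :
    SamePDropOfSkeletonConcLt := by
  refine samePDropOfSkeletonConcLt_of_centred fun {V} _ _ G _ Φ hc t ht h0 p hp1 hU hC hθ => ?_
  have hp : 0 < (p : ℝ) := pos_of_theta_pos G t hθ
  obtain ⟨ι, s, A, F, c, hA, hc', hstep⟩ := h G Φ hc t ht h0 p hp1 hU hC hθ
  -- (A) persists on `[q₀, p]`, `q₀ ≥ p/2` (upper family empty)
  obtain ⟨q₀, hq₀h, hq₀p, hopen⟩ := SameP.inputs_open_Icc G s A F hA c (∅ : Finset Unit) (fun _ => ∅) (fun _ => ∅)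
    (fun j hj => absurd hj (by simp)) (fun _ => 0) p hp hc' (fun j hj => absurd hj (by simp))
  have hq₀0 : 0 < (q₀ : ℝ) := by linarith
  obtain ⟨hcq, -⟩ := hopen q₀ le_rfl hq₀p.le
  have hCq : Φ.toPlanarSkeleton.CylSubcritical q₀ := Φ.toPlanarSkeleton.cylSubcritical_mono (Subtype.coe_le_coe.1 hq₀p.le) hC
  obtain ⟨A', S, FD, LD, ε', δ₂, hroot, hSp, hΓ, hAn, hsep, hX, hSt, hL, hδc, hε', hδ₂, hKε, hkit⟩ := hstep q₀ hq₀h hq₀p.le hcq hCq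
  have hθq : 0 < theta G S.Γ.root S.p :=
    KSchA.theta_pos_of_kitAtRun hΓ hAn hsep hX hSt hL hδc le_rfl hε' hδ₂ hKε (by rw [hSp]; exact hq₀0) hkit
  rw [hroot, hSp] at hθq
  exact ⟨q₀, hq₀p, hθq⟩

end SkelConc

end Transplant

end Summit.CriticalPhenomena.PercolationContinuityZ3.Theorems

end
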